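import Summits.Schanuel.Schanuel.Theses.TateNomes
import Literature.NumberTheory.Transcendental.OneMotiveToricProofs

/-!
# `NomeHygiene` (stmt-Schanuel-17298): load-bearing features of the crux

Negative-side support lemmas for the crux `Summit.Schanuel.Schanuel.Theses.TateNomes.NomeHygiene`
(route `TateNomes`, rank 3; the crux itself is PROVED along the line `integer_shift_rebase`:
`Cruxes/NomeHygiene/NomeHygieneComplete.lean`, stubs landed as
`Theorems/TateNomesNomeHygieneStubShiftCoincidence.lean` / `…StubShiftedTateBasis.lean`), from the crux
disprover's cycle-1 attack (`Cruxes/NomeHygiene/Disproof.lean`):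

* `nomeHygiene_false_without_linIndep` — the only hypothesis `LinearIndependent ℚ z` is load-bearing:
  the rigid count `w : Fin (n + k)` with `LinearIndependent ℚ w` and the span equality force
  `finrank (span (z, e)) = n + k`, false for `z = 0 : Fin 1 → ℂ` (`span (0, e) = span e`, rank `≤ k`).
* `no_tatePosition_of_le_two` — NO `ℚ`-tuple of length `≤ 2` is in Tate position: `2πi ∈ span w`
  makes a nome rational (`m = 1`, root of `X² − τ₀X`) or yields the affine `GL₂⁺(ℚ)`-relation
  `τ₁ = ατ₀ + β` with `α > 0` forced by `Im τⱼ = −Re wⱼ/2π > 0` (`m = 2`). Hence every witness of the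
  crux has `3 ≤ n + k` (`three_le_of_tatePosition`), and
* `not_nomeHygiene_k_le_two` — the strengthening "`k ≤ 2` adjoined numbers always suffice" is FALSE
  (`n = 0` needs `k = 3`): the proved line's enlargement bound `k ≤ 3` is sharp.
* `nomeHygiene_false_without_expOption` — the disjunct `IsAlgebraic ℚ (exp (e i))` is load-bearing:
  with algebraic `e` only, `span (z, e) ⊆ ℚ̄` at `n = 0`, which misses `2πi` (Lindemann 1882; tree
  `Literature.NumberTheory.Transcendental.transcendental_two_pi_I`).
-/

noncomputable section

-- `Summit.Schanuel.Schanuel.…` is the mandated namespace (single-conjunct summit).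
set_option linter.dupNamespace false

namespace Summit.Schanuel.Schanuel.Theorems.NomeHygiene.Negative

open Complex

/-! ## Tools -/

/-- `2πi ≠ 0`. [folklore] -/
theorem twoPiI_ne_zero : (2 * (Real.pi : ℂ) * Complex.I) ≠ 0 :=
  mul_ne_zero (mul_ne_zero two_ne_zero (Complex.ofReal_ne_zero.mpr Real.pi_ne_zero)) Complex.I_ne_zero

/-- The nome coordinate: `Im (w / 2πi) = −Re w / 2π`. [folklore] -/
theorem im_div_twoPiI (w : ℂ) :
    (w / (2 * (Real.pi : ℂ) * Complex.I)).im = -w.re / (2 * Real.pi) := by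
  have hT := twoPiI_ne_zero
  have hw : w = (2 * (Real.pi : ℂ) * Complex.I) * (w / (2 * (Real.pi : ℂ) * Complex.I)) := by
    field_simp
  have hre : w.re = -(2 * Real.pi) * (w / (2 * (Real.pi : ℂ) * Complex.I)).im := by
    conv_lhs => rw [hw]
    simp [Complex.mul_re]
  have hpi : (2 * Real.pi) ≠ 0 := by positivity
  field_simp
  linarith

/-- `Re w < 0 ⇒ Im (w/2πi) > 0`: Tate-position nomes lie in the upper half plane. [folklore] -/
theorem im_div_twoPiI_pos {w : ℂ} (hw : w.re < 0) :
    0 < (w / (2 * (Real.pi : ℂ) * Complex.I)).im := by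
  rw [im_div_twoPiI]
  apply div_pos (by linarith) (by positivity)

/-! ## The hypothesis `LinearIndependent ℚ z` is load-bearing -/

/-- **Any proof of `NomeHygiene` must use `LinearIndependent ℚ z`.** The crux with that hypothesis
dropped is false: at `n = 1`, `z = 0` the conclusion forces `finrank (span (range w)) = 1 + k` while
`span (range z ∪ range e) = span (range e)` has `finrank ≤ k`. [folklore] -/
theorem nomeHygiene_false_without_linIndep :
    ¬ ∀ (n : ℕ) (z : Fin n → ℂ), ∃ (k : ℕ) (e : Fin k → ℂ) (w : Fin (n + k) → ℂ), (∀ i, IsAlgebraic ℚ (e i) ∨ IsAlgebraic ℚ (Complex.exp (e i))) ∧ LinearIndependent ℚ w ∧ Submodule.span ℚ (Set.range w) = Submodule.span ℚ (Set.range z ∪ Set.range e) ∧ (2 * (Real.pi : ℂ) * Complex.I) ∈ Submodule.span ℚ (Set.range w) ∧ (∀ j, (w j).re < 0) ∧ (∀ j, ∀ b c : ℚ, (w j / (2 * (Real.pi : ℂ) * Complex.I)) ^ 2 + (b : ℂ) * (w j / (2 * (Real.pi : ℂ) * Complex.I)) + (c : ℂ) ≠ 0) ∧ (∀ i j, i ≠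 j → ∀ a b c d : ℚ, 0 < a * d - b * c → (w j / (2 * (Real.pi : ℂ) * Complex.I)) * ((c : ℂ) * (w i / (2 * (Real.pi : ℂ) * Complex.I)) + (d : ℂ)) ≠ (a : ℂ) * (w i / (2 * (Real.pi : ℂ) * Complex.I)) + (b : ℂ)) := by
  intro h
  obtain ⟨k, e, w, -, hw, hspan, -⟩ := h 1 (fun _ => 0)
  have h1 : Module.finrank ℚ (Submodule.span ℚ (Set.range w)) = 1 + k := by
    rw [finrank_span_eq_card hw, Fintype.card_fin]
  have hz : Submodule.span ℚ (Set.range (fun _ : Fin 1 => (0 : ℂ))) = ⊥ := by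
    rw [Submodule.span_eq_bot]
    rintro x ⟨i, rfl⟩
    rfl
  have h2 : Module.finrank ℚ
      (Submodule.span ℚ (Set.range (fun _ : Fin 1 => (0 : ℂ)) ∪ Set.range e)) ≤ k := by
    rw [Submodule.span_union, hz, bot_sup_eq]
    exact (finrank_range_le_card e).trans (by simp)
  rw [hspan] at h1
  omega

/-! ## Boundary: no Tate position in dimension `≤ 2`; the line's `k ≤ 3` is sharp -/

/-- **No Tate position for `m ≤ 2`.** If `w : Fin m → ℂ`, `m ≤ 2`, has `2πi ∈ span w`, all
`Re wⱼ < 0`, non-quadratic nomes and pairwise `GL₂⁺(ℚ)`-unrelated nomes (conjuncts 4–7 of the crux,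
verbatim), contradiction: `m = 0`: `2πi ∈ ⊥`; `m = 1`: `2πi = c·w₀` makes `τ₀ = 1/c` a root of
`X² − (1/c)X`; `m = 2`: `1 = c₀τ₀ + c₁τ₁`, and `c₁ = 0` is the previous case, else `τ₁ = ατ₀ + β`,
`α = −c₀/c₁ > 0` because `Im τ₀, Im τ₁ > 0` — the relation `(a,b,c,d) = (α,β,0,1)`, `ad − bc = α`.
[folklore] -/
theorem no_tatePosition_of_le_two {m : ℕ} (hm : m ≤ 2) (w : Fin m → ℂ)
    (hmem : (2 * (Real.pi : ℂ) * Complex.I) ∈ Submodule.span ℚ (Set.range w))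
    (hre : ∀ j, (w j).re < 0)
    (hnq : ∀ j, ∀ b c : ℚ, (w j / (2 * (Real.pi : ℂ) * Complex.I)) ^ 2 + (b : ℂ) * (w j / (2 * (Real.pi : ℂ) * Complex.I)) + (c : ℂ) ≠ 0)
    (hiso : ∀ i j, i ≠ j → ∀ a b c d : ℚ, 0 < a * d - b * c → (w j / (2 * (Real.pi : ℂ) * Complex.I)) * ((c : ℂ) * (w i / (2 * (Real.pi : ℂ) * Complex.I)) + (d : ℂ)) ≠ (a : ℂ) * (w i / (2 * (Real.pi : ℂ) * Complex.I)) + (b : ℂ)) :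
    False := by
  have hT := twoPiI_ne_zero
  obtain ⟨c, hc⟩ := (Submodule.mem_span_range_iff_exists_fun ℚ).1 hmem
  have himpos : ∀ j, 0 < (w j / (2 * (Real.pi : ℂ) * Complex.I)).im :=
    fun j => im_div_twoPiI_pos (hre j)
  interval_cases m
  · -- m = 0
    rw [Fin.sum_univ_zero] at hc
    exact hT hc.symm
  · -- m = 1
    rw [Fin.sum_univ_one, Rat.smul_def] at hc
    have hc0 : (c 0 : ℂ) ≠ 0 := by
      intro h0
      rw [h0, zero_mul] at hc
      exact hT hc.symm
    have hw0 : w 0 ≠ 0 := by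
      intro h0
      have := hre 0
      rw [h0, Complex.zero_re] at this
      exact lt_irrefl _ this
    have hτ : w 0 / (2 * (Real.pi : ℂ) * Complex.I) = ((c 0 : ℚ) : ℂ)⁻¹ := by
      rw [← hc]
      field_simp
    refine hnq 0 (-(c 0)⁻¹) 0 ?_
    rw [hτ]
    push_cast
    ring
  · -- m = 2
    rw [Fin.sum_univ_two, Rat.smul_def, Rat.smul_def] at hc
    by_cases h1 : c 1 = 0
    · rw [h1] at hc
      push_cast at hc
      rw [zero_mul, add_zero] at hc
      have hc0 : (c 0 : ℂ) ≠ 0 := by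
        intro h0
        rw [h0, zero_mul] at hc
        exact hT hc.symm
      have hw0 : w 0 ≠ 0 := by
        intro h0
        have := hre 0
        rw [h0, Complex.zero_re] at this
        exact lt_irrefl _ this
      have hτ : w 0 / (2 * (Real.pi : ℂ) * Complex.I) = ((c 0 : ℚ) : ℂ)⁻¹ := by
        rw [← hc]
        field_simp
      refine hnq 0 (-(c 0)⁻¹) 0 ?_
      rw [hτ]
      push_cast
      ring
    · have h1' : ((c 1 : ℚ) : ℂ) ≠ 0 := by exact_mod_cast h1
      set τ0 := w 0 / (2 * (Real.pi : ℂ) * Complex.I) with hτ0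
      set τ1 := w 1 / (2 * (Real.pi : ℂ) * Complex.I) with hτ1
      have hw0 : w 0 = (2 * (Real.pi : ℂ) * Complex.I) * τ0 := by rw [hτ0]; field_simp
      have hw1 : w 1 = (2 * (Real.pi : ℂ) * Complex.I) * τ1 := by rw [hτ1]; field_simp
      have hlin : (c 0 : ℂ) * τ0 + (c 1 : ℂ) * τ1 = 1 := by
        rw [hw0, hw1] at hc
        have : (2 * (Real.pi : ℂ) * Complex.I) * ((c 0 : ℂ) * τ0 + (c 1 : ℂ) * τ1 - 1) = 0 := by
          linear_combination hc
        have := (mul_eq_zero.1 this).resolve_left hT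
        linear_combination this
      have hrel : τ1 = ((-c 0 / c 1 : ℚ) : ℂ) * τ0 + ((1 / c 1 : ℚ) : ℂ) := by
        push_cast
        field_simp
        linear_combination hlin
      have hα : 0 < -c 0 / c 1 := by
        have him := congrArg Complex.im hrel
        simp only [Complex.add_im, Complex.mul_im, Complex.ratCast_re, Complex.ratCast_im,
          zero_mul, add_zero] at him
        have h0 := himpos 0
        have h1p := himpos 1
        rw [← hτ0] at h0
        rw [← hτ1, him] at h1p
        refine lt_of_not_ge fun hle => ?_
        have : ((-c 0 / c 1 : ℚ) : ℝ) ≤ 0 := by exact_mod_cast hle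
        nlinarith
      refine hiso 0 1 (by decide) (-c 0 / c 1) (1 / c 1) 0 1 (by linarith) ?_
      rw [← hτ0, ← hτ1, hrel]
      push_cast
      ring

/-- **Every witness of the crux has `3 ≤ n + k`** (for `w : Fin m → ℂ` in Tate position, `3 ≤ m`).
[folklore] -/
theorem three_le_of_tatePosition {m : ℕ} (w : Fin m → ℂ)
    (hmem : (2 * (Real.pi : ℂ) * Complex.I) ∈ Submodule.span ℚ (Set.range w))
    (hre : ∀ j, (w j).re < 0)
    (hnq : ∀ j, ∀ b c : ℚ, (w j / (2 * (Real.pi : ℂ) * Complex.I)) ^ 2 + (b : ℂ) * (w j / (2 * (Real.pi : ℂ) * Complex.I)) + (c : ℂ) ≠ 0)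
    (hiso : ∀ i j, i ≠ j → ∀ a b c d : ℚ, 0 < a * d - b * c → (w j / (2 * (Real.pi : ℂ) * Complex.I)) * ((c : ℂ) * (w i / (2 * (Real.pi : ℂ) * Complex.I)) + (d : ℂ)) ≠ (a : ℂ) * (w i / (2 * (Real.pi : ℂ) * Complex.I)) + (b : ℂ)) :
    3 ≤ m := by
  by_contra hlt
  exact no_tatePosition_of_le_two (by omega) w hmem hre hnq hiso

/-- **The enlargement bound `k ≤ 3` of the proved line is sharp**: the strengthening of the crux by
`k ≤ 2` is false — at `n = 0` any witness is a Tate tuple of length `0 + k`, so `k ≥ 3`. [folklore] -/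
theorem not_nomeHygiene_k_le_two :
    ¬ ∀ (n : ℕ) (z : Fin n → ℂ), LinearIndependent ℚ z → ∃ (k : ℕ) (e : Fin k → ℂ) (w : Fin (n + k) → ℂ), k ≤ 2 ∧ (∀ i, IsAlgebraic ℚ (e i) ∨ IsAlgebraic ℚ (Complex.exp (e i))) ∧ LinearIndependent ℚ w ∧ Submodule.span ℚ (Set.range w) = Submodule.span ℚ (Set.range z ∪ Set.range e) ∧ (2 * (Real.pi : ℂ) * Complex.I) ∈ Submodule.span ℚ (Set.range w) ∧ (∀ j, (w j).re < 0) ∧ (∀ j, ∀ b c : ℚ, (w j / (2 * (Real.pi : ℂ) * Complex.I)) ^ 2 + (b : ℂ) * (w j / (2 * (Real.pi : ℂ) * Complex.I)) + (c : ℂ) ≠ 0) ∧ (∀ i j, i ≠ j → ∀ a b c d : ℚ, 0 < a * d - b * c → (w j / (2 * (Real.pi : ℂ) * Complex.I)) * ((c : ℂ) * (w i / (2 * (Real.pi : ℂ) * Complex.I)) + (d : ℂ)) ≠ (a : ℂ) * (w i / (2 * (Real.pi : ℂ) * Complex.I)) + (b : ℂ)) := by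
  intro h
  obtain ⟨k, e, w, hk, -, -, -, hmem, hre, hnq, hiso⟩ :=
    h 0 (Fin.elim0 : Fin 0 → ℂ) linearIndependent_empty_type
  have h3 : 3 ≤ 0 + k := three_le_of_tatePosition w hmem hre hnq hiso
  omega

/-! ## The `exp`-algebraic option for the adjoined numbers is load-bearing -/

/-- **Any proof of `NomeHygiene` must use the option `IsAlgebraic ℚ (exp (e i))`** (it is what brings
`2πi` into the span): the crux with the adjoined `e i` restricted to algebraic numbers is false — at
`n = 0`, `span (range e) ⊆ ℚ̄` misses `2πi` (Lindemann; tree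
`Literature.NumberTheory.Transcendental.transcendental_two_pi_I`). [cite: Lindemann1882] -/
theorem nomeHygiene_false_without_expOption :
    ¬ ∀ (n : ℕ) (z : Fin n → ℂ), LinearIndependent ℚ z → ∃ (k : ℕ) (e : Fin k → ℂ) (w : Fin (n + k) → ℂ), (∀ i, IsAlgebraic ℚ (e i)) ∧ LinearIndependent ℚ w ∧ Submodule.span ℚ (Set.range w) = Submodule.span ℚ (Set.range z ∪ Set.range e) ∧ (2 * (Real.pi : ℂ) * Complex.I) ∈ Submodule.span ℚ (Set.range w) ∧ (∀ j, (w j).re < 0) ∧ (∀ j, ∀ b c : ℚ, (w j / (2 * (Real.pi : ℂ) * Complex.I)) ^ 2 + (b : ℂ) * (w j / (2 * (Real.pi : ℂ) * Complex.I)) + (c : ℂ) ≠ 0) ∧ (∀ i j, i ≠ j → ∀ a b c d : ℚ, 0 < a * d - b * c → (w j / (2 * (Real.pi : ℂ) * Complex.I)) * ((c : ℂ) * (w i / (2 * (Real.pi : ℂ) * Complex.I)) + (d : ℂ)) ≠ (a : ℂ) * (w i / (2 * (Real.pi : ℂ) * Complex.I)) + (b : ℂ)) := by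
  intro h
  obtain ⟨k, e, w, he, -, hspan, hmem, -⟩ :=
    h 0 (Fin.elim0 : Fin 0 → ℂ) linearIndependent_empty_type
  rw [hspan] at hmem
  have hsub : Submodule.span ℚ (Set.range (Fin.elim0 : Fin 0 → ℂ) ∪ Set.range e) ≤
      Subalgebra.toSubmodule (integralClosure ℚ ℂ) := by
    rw [Submodule.span_le]
    rintro x (⟨i, -⟩ | ⟨i, rfl⟩)
    · exact i.elim0
    · exact (mem_integralClosure_iff ℚ ℂ).2 (he i).isIntegral
  have hint : IsIntegral ℚ (2 * (Real.pi : ℂ) * Complex.I) :=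
    (mem_integralClosure_iff ℚ ℂ).1 (hsub hmem)
  exact Literature.NumberTheory.Transcendental.transcendental_two_pi_I hint.isAlgebraic

end Summit.Schanuel.Schanuel.Theorems.NomeHygiene.Negative
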